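import Mathlib
import Summits.Ventures.HodgeRepro.Tier4.Line1.ThreeLines
import Summits.Ventures.HodgeRepro.Tier4.Line4.TransporterDichotomy
import Summits.Ventures.HodgeRepro.Tier4.Line4.OrbitBlocks

/-!
# Tier4/Line4/Dichotomy — C-L4-DICHOTOMY = (S-DICH): a rational point that is not a transporter is regular

Blind re-derivation cell `pub-hodge-repro`, Tier 4 «prove the step» (README §9–§10), seat t4-L1-p1 (prover, LINE L1,
gen 4; plan-4 g5's cut by name S15403, L2-p3's shape S15390).  Tree path
`lean/Summits/Ventures/HodgeRepro/Tier4/Line4/Dichotomy.lean`.  Mathlib-level; no literature.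

WHAT IS PROVED (every declaration sorry-free, axioms `[propext, Classical.choice, Quot.sound]`).
**`isRegularRational_of_not_transporter (hg : IsGenuine W) (γ : rationalPoints W)
(h : (torusT W).map (MulAut.conj ((γ : GA W))⁻¹).toMonoidHom ≠ torusT' W) : IsRegularRational W γ`** — the
stabiliser of a NON-TRANSPORTER rational point `γ` (`γ⁻¹ T γ ≠ T′`) in `T × T′` is the diagonal centre
(`IsRegularRational`, PlaneDefs-v0.2: `∀ t ∈ T, ∀ t′ ∈ T′, t⁻¹ γ t′ = γ → t ∈ centre ∧ t′ = t`).
PROOF.  `t⁻¹ γ t′ = γ` gives `t′ = γ⁻¹ t γ`, so `t` commutes with the RATIONAL rank-2 `Ω`-stable projectors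
`R j = u (Q j) u⁻¹` (`u` = the rational matrix of `γ`, `exists_rational_gl`).  THE DICHOTOMY on the lines: if `im R₀` (or
`im R₁`) is neither `P`-line, L1-p3's ThreeLines (`exists_mem_range_components_ne_zero` + `mat_eq_scalar_of_three_lines`)
makes `GA.mat W t` an `E′_𝔸`-scalar, so `t` is central (`mem_center_of_mat_eq_scalar`) and `t′ = γ⁻¹ t γ = t`; otherwise
both `im R₀`, `im R₁` are `P`-lines, distinct (`R₀ R₁ = 0`), so the projectors COINCIDE with the `P`-projectors (same
image and kernel: `eq_of_range_eq_of_range_compl_eq`), i.e. `Q j = u⁻¹ P_{σ j} u`, and then `γ⁻¹ T γ = T′`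
(`map_torusT_eq_torusT'_of_conj`) — against `h`.
BINDERS: `IsGenuine W` (L1-p3's genericity: `Ω² = −d` with `−d` a non-square, the `B`-clauses (unused here),
`rank (P i) = rank (Q i) = 2`); nothing else.  `ne_zero_of_rank_eq_two` is L2-p3's (OrbitBlocks), by name.  Junk: a degenerate plane (`Q 0 = 0`) is excluded by the rank clause —
there `T′ = G(𝔸)` and the statement is false, which is why the binder is needed.

Nothing here says anything about the status of the Hodge conjecture for CM abelian varieties, which is NOT proved
(HC_CM is NOT proved by anyone in this repository).
-/

set_option autoImplicit false
noncomputable section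
namespace Summit.Ventures.HodgeRepro.Tier4.Line4
open Summit.Ventures.HodgeRepro.Tier4 Summit.Ventures.HodgeRepro.Tier4.Common Summit.Ventures.HodgeRepro.Tier4.Line1
  NumberField Matrix

section Dichotomy

variable {k : Type} [Field k] [NumberField k] (W : PlaneData k)

/-! ### Projectors: equality from image and complement -/

omit [NumberField k] in
/-- an idempotent is the identity on its range. -/
theorem idem_mulVec_of_mem_range {A : Matrix (Fin 4) (Fin 4) k} (hA : A * A = A) {v : Fin 4 → k}
    (hv : v ∈ LinearMap.range A.mulVecLin) : A *ᵥ v = v := by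
  obtain ⟨w, rfl⟩ := hv
  simp only [mulVecLin_apply, mulVec_mulVec, hA]

omit [NumberField k] in
/-- **two complementary pairs of idempotents with the same images coincide**: `A + A′ = 1`, `B + B′ = 1`,
`im A = im B`, `im A′ = im B′` ⇒ `A = B`. -/
theorem eq_of_range_eq_of_range_compl_eq {A A' B B' : Matrix (Fin 4) (Fin 4) k}
    (hA : A * A = A) (hA' : A * A' = 0) (hBsum : B + B' = 1)
    (h1 : LinearMap.range A.mulVecLin = LinearMap.range B.mulVecLin)
    (h2 : LinearMap.range A'.mulVecLin = LinearMap.range B'.mulVecLin) : A = B := by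
  apply Matrix.toLin'.injective
  apply LinearMap.ext
  intro v
  simp only [toLin'_apply]
  have hv : v = B *ᵥ v + B' *ᵥ v := by
    rw [← add_mulVec, hBsum, one_mulVec]
  have hB : B *ᵥ v ∈ LinearMap.range A.mulVecLin := by
    rw [h1]; exact ⟨v, rfl⟩
  have hB' : B' *ᵥ v ∈ LinearMap.range A'.mulVecLin := by
    rw [h2]; exact ⟨v, rfl⟩
  obtain ⟨w, hw⟩ := hB'
  simp only [mulVecLin_apply] at hw
  calc A *ᵥ v = A *ᵥ (B *ᵥ v + B' *ᵥ v) := by rw [← hv]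
    _ = A *ᵥ (B *ᵥ v) + A *ᵥ (B' *ᵥ v) := mulVec_add _ _ _
    _ = B *ᵥ v + A *ᵥ (A' *ᵥ w) := by rw [idem_mulVec_of_mem_range hA hB, ← hw]
    _ = B *ᵥ v := by rw [mulVec_mulVec, hA', zero_mulVec, add_zero]

omit [NumberField k] in
/-- the ranges of two complementary idempotents with `A′ ≠ 0` differ (`A′ A = 0`). -/
theorem range_ne_range_compl {A A' : Matrix (Fin 4) (Fin 4) k} (hA' : A' * A' = A') (hsum : A + A' = 1)
    (hne : A' ≠ 0) : LinearMap.range A.mulVecLin ≠ LinearMap.range A'.mulVecLin := by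
  have hA'A : A' * A = 0 := by
    have : A = 1 - A' := eq_sub_of_add_eq hsum
    rw [this, mul_sub, mul_one, hA', sub_self]
  intro heq
  apply hne
  apply Matrix.toLin'.injective
  apply LinearMap.ext
  intro v
  simp only [toLin'_apply]
  rw [zero_mulVec]
  have hv : A' *ᵥ v ∈ LinearMap.range A.mulVecLin := by
    rw [heq]; exact ⟨v, rfl⟩
  obtain ⟨w, hw⟩ := hv
  simp only [mulVecLin_apply] at hw
  calc A' *ᵥ v = A' *ᵥ (A' *ᵥ v) := by rw [mulVec_mulVec, hA']
    _ = A' *ᵥ (A *ᵥ w) := by rw [hw]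
    _ = 0 := by rw [mulVec_mulVec, hA'A, zero_mulVec]

/-! ### The transported projectors `R j = u (Q j) u⁻¹` -/

/-- the rational matrix of a rational point commutes with `Ω`. -/
theorem rational_mat_comm_Ω (γ : rationalPoints W) (u : GL (Fin 4) k)
    (hu : GA.mat W (γ : GA W) = adMat k (u : Matrix (Fin 4) (Fin 4) k)) :
    (u : Matrix (Fin 4) (Fin 4) k) * W.Ω = W.Ω * u := by
  apply adMat_injective
  rw [adMat_mul, adMat_mul, ← hu]
  exact ((mem_unitaryGroup W _).1 (γ : GA W).2).1

omit [NumberField k] in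
/-- the inverse of the rational matrix commutes with `Ω`. -/
theorem rational_mat_inv_comm_Ω (u : GL (Fin 4) k) (hcomm : (u : Matrix (Fin 4) (Fin 4) k) * W.Ω = W.Ω * u) :
    ((u⁻¹ : GL (Fin 4) k) : Matrix (Fin 4) (Fin 4) k) * W.Ω = W.Ω * (u⁻¹ : GL (Fin 4) k) := by
  calc ((u⁻¹ : GL (Fin 4) k) : Matrix (Fin 4) (Fin 4) k) * W.Ω
      = (u⁻¹ : GL (Fin 4) k) * W.Ω * ((u : Matrix (Fin 4) (Fin 4) k) * (u⁻¹ : GL (Fin 4) k)) := by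
        rw [Units.mul_inv, mul_one]
    _ = (u⁻¹ : GL (Fin 4) k) * (W.Ω * u) * (u⁻¹ : GL (Fin 4) k) := by simp only [mul_assoc]
    _ = (u⁻¹ : GL (Fin 4) k) * (u * W.Ω) * (u⁻¹ : GL (Fin 4) k) := by rw [hcomm]
    _ = ((u⁻¹ : GL (Fin 4) k) * u) * W.Ω * (u⁻¹ : GL (Fin 4) k) := by simp only [mul_assoc]
    _ = W.Ω * (u⁻¹ : GL (Fin 4) k) := by rw [Units.inv_mul, one_mul]

omit [NumberField k] in
/-- **the transported projector** `R j := u (Q j) u⁻¹` (rational). -/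
def conjProj (u : GL (Fin 4) k) (j : Fin 2) : Matrix (Fin 4) (Fin 4) k :=
  (u : Matrix (Fin 4) (Fin 4) k) * W.Q j * (u⁻¹ : GL (Fin 4) k)

omit [NumberField k] in
/-- `R j` commutes with `Ω`. -/
theorem conjProj_comm_Ω (u : GL (Fin 4) k) (hcomm : (u : Matrix (Fin 4) (Fin 4) k) * W.Ω = W.Ω * u) (j : Fin 2) :
    conjProj W u j * W.Ω = W.Ω * conjProj W u j := by
  have hcomm' : ((u⁻¹ : GL (Fin 4) k) : Matrix (Fin 4) (Fin 4) k) * W.Ω = W.Ω * (u⁻¹ : GL (Fin 4) k) := by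
    calc ((u⁻¹ : GL (Fin 4) k) : Matrix (Fin 4) (Fin 4) k) * W.Ω
        = (u⁻¹ : GL (Fin 4) k) * W.Ω * ((u : Matrix (Fin 4) (Fin 4) k) * (u⁻¹ : GL (Fin 4) k)) := by
          rw [Units.mul_inv, mul_one]
      _ = (u⁻¹ : GL (Fin 4) k) * (W.Ω * u) * (u⁻¹ : GL (Fin 4) k) := by simp only [mul_assoc]
      _ = (u⁻¹ : GL (Fin 4) k) * (u * W.Ω) * (u⁻¹ : GL (Fin 4) k) := by rw [hcomm]
      _ = ((u⁻¹ : GL (Fin 4) k) * u) * W.Ω * (u⁻¹ : GL (Fin 4) k) := by simp only [mul_assoc]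
      _ = W.Ω * (u⁻¹ : GL (Fin 4) k) := by rw [Units.inv_mul, one_mul]
  unfold conjProj
  calc (u : Matrix (Fin 4) (Fin 4) k) * W.Q j * (u⁻¹ : GL (Fin 4) k) * W.Ω
      = (u : Matrix (Fin 4) (Fin 4) k) * W.Q j * ((u⁻¹ : GL (Fin 4) k) * W.Ω) := by simp only [mul_assoc]
    _ = (u : Matrix (Fin 4) (Fin 4) k) * W.Q j * (W.Ω * (u⁻¹ : GL (Fin 4) k)) := by rw [hcomm']
    _ = (u : Matrix (Fin 4) (Fin 4) k) * (W.Q j * W.Ω) * (u⁻¹ : GL (Fin 4) k) := by simp only [mul_assoc]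
    _ = (u : Matrix (Fin 4) (Fin 4) k) * (W.Ω * W.Q j) * (u⁻¹ : GL (Fin 4) k) := by rw [W.Q_comm j]
    _ = ((u : Matrix (Fin 4) (Fin 4) k) * W.Ω) * W.Q j * (u⁻¹ : GL (Fin 4) k) := by simp only [mul_assoc]
    _ = (W.Ω * u) * W.Q j * (u⁻¹ : GL (Fin 4) k) := by rw [hcomm]
    _ = W.Ω * conjProj W u j := by unfold conjProj; simp only [mul_assoc]

omit [NumberField k] in
/-- `R j` is idempotent. -/
theorem conjProj_idem (u : GL (Fin 4) k) (j : Fin 2) : conjProj W u j * conjProj W u j = conjProj W u j := by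
  unfold conjProj
  calc (u : Matrix (Fin 4) (Fin 4) k) * W.Q j * (u⁻¹ : GL (Fin 4) k) * ((u : Matrix (Fin 4) (Fin 4) k) * W.Q j *
        (u⁻¹ : GL (Fin 4) k))
      = (u : Matrix (Fin 4) (Fin 4) k) * W.Q j * (((u⁻¹ : GL (Fin 4) k) : Matrix (Fin 4) (Fin 4) k) * u) *
          W.Q j * (u⁻¹ : GL (Fin 4) k) := by simp only [mul_assoc]
    _ = (u : Matrix (Fin 4) (Fin 4) k) * (W.Q j * W.Q j) * (u⁻¹ : GL (Fin 4) k) := by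
        rw [Units.inv_mul, mul_one]; simp only [mul_assoc]
    _ = (u : Matrix (Fin 4) (Fin 4) k) * W.Q j * (u⁻¹ : GL (Fin 4) k) := by rw [W.Q_idem j]

omit [NumberField k] in
/-- `R 0 + R 1 = 1`. -/
theorem conjProj_sum (u : GL (Fin 4) k) : conjProj W u 0 + conjProj W u 1 = 1 := by
  unfold conjProj
  rw [← add_mul, ← mul_add, W.Q_sum, mul_one, Units.mul_inv]

omit [NumberField k] in
/-- `R 0 R 1 = 0`. -/
theorem conjProj_mul_zero_one (u : GL (Fin 4) k) : conjProj W u 0 * conjProj W u 1 = 0 := by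
  have h := conjProj_idem W u 0
  have hsum := conjProj_sum W u
  have : conjProj W u 1 = 1 - conjProj W u 0 := eq_sub_of_add_eq' hsum
  rw [this, mul_sub, mul_one, h, sub_self]

omit [NumberField k] in
/-- `R j` has the rank of `Q j`. -/
theorem conjProj_rank (u : GL (Fin 4) k) (j : Fin 2) : (conjProj W u j).rank = (W.Q j).rank := by
  unfold conjProj
  have hu : IsUnit (u : Matrix (Fin 4) (Fin 4) k).det := (Matrix.isUnit_iff_isUnit_det _).1 u.isUnit
  have hu' : IsUnit ((u⁻¹ : GL (Fin 4) k) : Matrix (Fin 4) (Fin 4) k).det :=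
    (Matrix.isUnit_iff_isUnit_det _).1 (u⁻¹).isUnit
  rw [rank_mul_eq_left_of_isUnit_det _ _ hu', rank_mul_eq_right_of_isUnit_det _ _ hu]

omit [NumberField k] in
/-- `R j = P i` transports `Q j` to `u⁻¹ P i u`. -/
theorem Q_eq_of_conjProj_eq (u : GL (Fin 4) k) {j : Fin 2} {i : Fin 2} (h : conjProj W u j = W.P i) :
    W.Q j = ((u⁻¹ : GL (Fin 4) k) : Matrix (Fin 4) (Fin 4) k) * W.P i * u := by
  unfold conjProj at h
  calc W.Q j = (((u⁻¹ : GL (Fin 4) k) : Matrix (Fin 4) (Fin 4) k) * u) * W.Q j *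
        (((u⁻¹ : GL (Fin 4) k) : Matrix (Fin 4) (Fin 4) k) * u) := by
        rw [Units.inv_mul, one_mul, mul_one]
    _ = (u⁻¹ : GL (Fin 4) k) * ((u : Matrix (Fin 4) (Fin 4) k) * W.Q j * (u⁻¹ : GL (Fin 4) k)) * u := by
        simp only [mul_assoc]
    _ = ((u⁻¹ : GL (Fin 4) k) : Matrix (Fin 4) (Fin 4) k) * W.P i * u := by rw [h]

/-! ### The transporter: `γ⁻¹ T γ = T′` when the `Q`-projectors are the conjugated `P`-projectors -/

/-- `g ∈ γ⁻¹ T γ` iff `γ g γ⁻¹ ∈ T`. -/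
theorem mem_map_conj_iff (γ : rationalPoints W) (g : GA W) :
    g ∈ (torusT W).map (MulAut.conj ((γ : GA W))⁻¹).toMonoidHom ↔ (γ : GA W) * g * (γ : GA W)⁻¹ ∈ torusT W := by
  rw [Subgroup.mem_map]
  constructor
  · rintro ⟨s, hs, rfl⟩
    simp only [MulEquiv.coe_toMonoidHom, MulAut.conj_apply, inv_inv]
    have : (γ : GA W) * ((γ : GA W)⁻¹ * s * (γ : GA W)) * (γ : GA W)⁻¹ = s := by group
    rw [this]
    exact hs
  · intro hg
    refine ⟨(γ : GA W) * g * (γ : GA W)⁻¹, hg, ?_⟩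
    simp only [MulEquiv.coe_toMonoidHom, MulAut.conj_apply, inv_inv]
    group

/-- conjugating a commutation relation by the rational matrix: `γ g γ⁻¹` commutes with `adMat A` iff `g` commutes
with `adMat (u⁻¹ A u)`. -/
theorem conj_comm_iff (γ : rationalPoints W) (u : GL (Fin 4) k)
    (hu : GA.mat W (γ : GA W) = adMat k (u : Matrix (Fin 4) (Fin 4) k))
    (hu' : GA.mat W ((γ : GA W)⁻¹) = adMat k ((u⁻¹ : GL (Fin 4) k) : Matrix (Fin 4) (Fin 4) k))
    (g : GA W) (A : Matrix (Fin 4) (Fin 4) k) :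
    GA.mat W ((γ : GA W) * g * (γ : GA W)⁻¹) * adMat k A = adMat k A * GA.mat W ((γ : GA W) * g * (γ : GA W)⁻¹) ↔
      GA.mat W g * adMat k (((u⁻¹ : GL (Fin 4) k) : Matrix (Fin 4) (Fin 4) k) * A * u) =
        adMat k (((u⁻¹ : GL (Fin 4) k) : Matrix (Fin 4) (Fin 4) k) * A * u) * GA.mat W g := by
  have hm : GA.mat W ((γ : GA W) * g * (γ : GA W)⁻¹) =
      adMat k (u : Matrix (Fin 4) (Fin 4) k) * GA.mat W g * adMat k ((u⁻¹ : GL (Fin 4) k) : Matrix (Fin 4) (Fin 4) k) := by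
    rw [GA.mat_mul, GA.mat_mul, hu, hu']
  have hinv1 : adMat k ((u⁻¹ : GL (Fin 4) k) : Matrix (Fin 4) (Fin 4) k) * adMat k (u : Matrix (Fin 4) (Fin 4) k) = 1 := by
    rw [← adMat_mul, Units.inv_mul, adMat_one]
  have hinv2 : adMat k (u : Matrix (Fin 4) (Fin 4) k) * adMat k ((u⁻¹ : GL (Fin 4) k) : Matrix (Fin 4) (Fin 4) k) = 1 := by
    rw [← adMat_mul, Units.mul_inv, adMat_one]
  rw [hm, adMat_mul, adMat_mul]
  set U := adMat k (u : Matrix (Fin 4) (Fin 4) k)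
  set V := adMat k ((u⁻¹ : GL (Fin 4) k) : Matrix (Fin 4) (Fin 4) k)
  set X := GA.mat W g
  set Y := adMat k A
  constructor
  · intro h
    -- `X (V Y U) = V (U X V Y U) = V (Y U X V U) = V Y U X`
    calc X * (V * Y * U) = (V * U) * X * (V * Y * U) := by rw [hinv1, one_mul]
      _ = V * ((U * X * V) * Y) * U := by simp only [mul_assoc]
      _ = V * (Y * (U * X * V)) * U := by rw [h]
      _ = (V * Y * U) * X * (V * U) := by simp only [mul_assoc]
      _ = (V * Y * U) * X := by rw [hinv1, mul_one]
  · intro h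
    calc U * X * V * Y = U * X * V * Y * (U * V) := by rw [hinv2, mul_one]
      _ = U * (X * (V * Y * U)) * V := by simp only [mul_assoc]
      _ = U * ((V * Y * U) * X) * V := by rw [h]
      _ = (U * V) * Y * (U * X * V) := by simp only [mul_assoc]
      _ = Y * (U * X * V) := by rw [hinv2, one_mul]

/-- **the transporter identity**: if `Q 0 = u⁻¹ P i u` and `Q 1 = u⁻¹ P i′ u` with `{i, i′} = {0, 1}`, then
`γ⁻¹ T γ = T′`. -/
theorem map_torusT_eq_torusT'_of_conj (γ : rationalPoints W) (u : GL (Fin 4) k)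
    (hu : GA.mat W (γ : GA W) = adMat k (u : Matrix (Fin 4) (Fin 4) k))
    (hu' : GA.mat W ((γ : GA W)⁻¹) = adMat k ((u⁻¹ : GL (Fin 4) k) : Matrix (Fin 4) (Fin 4) k))
    {i i' : Fin 2} (hii' : ({i, i'} : Finset (Fin 2)) = Finset.univ)
    (h0 : W.Q 0 = ((u⁻¹ : GL (Fin 4) k) : Matrix (Fin 4) (Fin 4) k) * W.P i * u)
    (h1 : W.Q 1 = ((u⁻¹ : GL (Fin 4) k) : Matrix (Fin 4) (Fin 4) k) * W.P i' * u) :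
    (torusT W).map (MulAut.conj ((γ : GA W))⁻¹).toMonoidHom = torusT' W := by
  ext g
  rw [mem_map_conj_iff]
  -- membership in the tori, unfolded
  have hT : ∀ x : GA W, x ∈ torusT W ↔ (GA.mat W x * adMat k (W.P 0) = adMat k (W.P 0) * GA.mat W x) ∧
      (GA.mat W x * adMat k (W.P 1) = adMat k (W.P 1) * GA.mat W x) := fun _ => Iff.rfl
  have hT' : ∀ x : GA W, x ∈ torusT' W ↔ (GA.mat W x * adMat k (W.Q 0) = adMat k (W.Q 0) * GA.mat W x) ∧
      (GA.mat W x * adMat k (W.Q 1) = adMat k (W.Q 1) * GA.mat W x) := fun _ => Iff.rfl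
  rw [hT, hT', conj_comm_iff W γ u hu hu', conj_comm_iff W γ u hu hu', h0, h1]
  -- `{i, i'} = univ`: the pair `(P i, P i')` is `(P 0, P 1)` or `(P 1, P 0)`
  have hcases : (i = 0 ∧ i' = 1) ∨ (i = 1 ∧ i' = 0) := by
    have h0mem : (0 : Fin 2) ∈ ({i, i'} : Finset (Fin 2)) := by rw [hii']; exact Finset.mem_univ _
    have h1mem : (1 : Fin 2) ∈ ({i, i'} : Finset (Fin 2)) := by rw [hii']; exact Finset.mem_univ _
    simp only [Finset.mem_insert, Finset.mem_singleton] at h0mem h1mem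
    omega
  rcases hcases with ⟨rfl, rfl⟩ | ⟨rfl, rfl⟩
  · exact Iff.rfl
  · exact and_comm

/-! ### The dichotomy -/

/-- **(S-DICH) — a rational point that is not a transporter is regular**: if `γ⁻¹ T γ ≠ T′` then every stabiliser pair
`t⁻¹ γ t′ = γ` (`t ∈ T`, `t′ ∈ T′`) has `t` in the centre and `t′ = t`. -/
theorem isRegularRational_of_not_transporter (hg : IsGenuine W) (γ : rationalPoints W)
    (h : (torusT W).map (MulAut.conj ((γ : GA W))⁻¹).toMonoidHom ≠ torusT' W) :
    IsRegularRational W γ := by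
  obtain ⟨⟨d, hΩ, hd⟩, -, -, -, hPr, hQr⟩ := hg
  obtain ⟨u, hu, hu'⟩ := exists_rational_gl W γ
  have hcomm := rational_mat_comm_Ω W γ u hu
  intro t ht t' ht' hγ
  -- `t′ = γ⁻¹ t γ`
  have ht'eq : t' = (γ : GA W)⁻¹ * t * (γ : GA W) := by
    have h1 : (γ : GA W) * t' = t * γ := by
      calc (γ : GA W) * t' = t * (t⁻¹ * γ * t') := by group
        _ = t * γ := by rw [hγ]
    calc t' = (γ : GA W)⁻¹ * ((γ : GA W) * t') := by group
      _ = (γ : GA W)⁻¹ * (t * γ) := by rw [h1]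
      _ = (γ : GA W)⁻¹ * t * (γ : GA W) := by group
  -- `t` commutes with the transported projectors `R j`: `t = γ t′ γ⁻¹` and `t′` commutes with `Q j`
  have hteq : GA.mat W t = adMat k (u : Matrix (Fin 4) (Fin 4) k) * GA.mat W t' *
      adMat k ((u⁻¹ : GL (Fin 4) k) : Matrix (Fin 4) (Fin 4) k) := by
    have : t = (γ : GA W) * t' * (γ : GA W)⁻¹ := by rw [ht'eq]; group
    rw [this, GA.mat_mul, GA.mat_mul, hu, hu']
  have hinv1 : adMat k ((u⁻¹ : GL (Fin 4) k) : Matrix (Fin 4) (Fin 4) k) *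
      adMat k (u : Matrix (Fin 4) (Fin 4) k) = 1 := by
    rw [← adMat_mul, Units.inv_mul, adMat_one]
  have hRcomm : ∀ j : Fin 2, GA.mat W t * adMat k (conjProj W u j) = adMat k (conjProj W u j) * GA.mat W t := by
    intro j
    have hQ : GA.mat W t' * adMat k (W.Q j) = adMat k (W.Q j) * GA.mat W t' := by
      rcases j with ⟨j, hj⟩
      interval_cases j
      · exact ht'.1
      · exact ht'.2
    unfold conjProj
    rw [adMat_mul, adMat_mul, hteq]
    set U := adMat k (u : Matrix (Fin 4) (Fin 4) k)
    set V := adMat k ((u⁻¹ : GL (Fin 4) k) : Matrix (Fin 4) (Fin 4) k)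
    set X := GA.mat W t'
    set Y := adMat k (W.Q j)
    calc U * X * V * (U * Y * V) = U * X * (V * U) * Y * V := by simp only [mul_assoc]
      _ = U * (X * Y) * V := by rw [hinv1, mul_one]; simp only [mul_assoc]
      _ = U * (Y * X) * V := by rw [hQ]
      _ = U * Y * (V * U) * X * V := by rw [hinv1, mul_one]; simp only [mul_assoc]
      _ = U * Y * V * (U * X * V) := by simp only [mul_assoc]
  -- the facts about the transported projectors
  have hRΩ : ∀ j, conjProj W u j * W.Ω = W.Ω * conjProj W u j := conjProj_comm_Ω W u hcomm
  have hRr : ∀ j, (conjProj W u j).rank = 2 := fun j => by rw [conjProj_rank]; exact hQr j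
  -- a scalar `t` settles the claim
  have hscalar : ∀ j : Fin 2, (∃ z ∈ LinearMap.range (conjProj W u j).mulVecLin,
      W.P 0 *ᵥ z ≠ 0 ∧ W.P 1 *ᵥ z ≠ 0) → t ∈ centre W ∧ t' = t := by
    intro j hz
    obtain ⟨z, hzR, hx, hy⟩ := hz
    obtain ⟨c, e, hce⟩ := mat_eq_scalar_of_three_lines W hΩ hd (hPr 0) (hPr 1) (hRΩ j) (hRr j) hzR hx hy t
      ht.1 ht.2 (hRcomm j)
    have hcent : t ∈ Subgroup.center (GA W) := mem_center_of_mat_eq_scalar W t hce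
    have ht't : t' = t := by
      rw [ht'eq]
      have := (Subgroup.mem_center_iff.1 hcent) (γ : GA W)
      calc (γ : GA W)⁻¹ * t * (γ : GA W) = (γ : GA W)⁻¹ * (t * γ) := by group
        _ = (γ : GA W)⁻¹ * (γ * t) := by rw [← this]
        _ = t := by group
    refine ⟨⟨⟨ht, ?_⟩, hcent⟩, ht't⟩
    rw [← ht't]
    exact ht'
  -- the dichotomy on the two transported lines
  by_cases hz0 : ∃ z ∈ LinearMap.range (conjProj W u 0).mulVecLin, W.P 0 *ᵥ z ≠ 0 ∧ W.P 1 *ᵥ z ≠ 0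
  · exact hscalar 0 hz0
  by_cases hz1 : ∃ z ∈ LinearMap.range (conjProj W u 1).mulVecLin, W.P 0 *ᵥ z ≠ 0 ∧ W.P 1 *ᵥ z ≠ 0
  · exact hscalar 1 hz1
  -- both transported lines are `P`-lines
  have hline : ∀ j : Fin 2, LinearMap.range (conjProj W u j).mulVecLin = LinearMap.range (W.P 0).mulVecLin ∨
      LinearMap.range (conjProj W u j).mulVecLin = LinearMap.range (W.P 1).mulVecLin := by
    intro j
    by_contra hcon
    have hcon' := not_or.1 hcon
    have hz := exists_mem_range_components_ne_zero W hΩ hd (hPr 0) (hPr 1) (hRΩ j) (hRr j) hcon'.1 hcon'.2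
    rcases j with ⟨j, hj⟩
    interval_cases j
    · exact hz0 hz
    · exact hz1 hz
  exfalso
  apply h
  -- the two transported lines are distinct, so they are the two `P`-lines in some order
  have hne : LinearMap.range (conjProj W u 0).mulVecLin ≠ LinearMap.range (conjProj W u 1).mulVecLin :=
    range_ne_range_compl (conjProj_idem W u 1) (conjProj_sum W u) (ne_zero_of_rank_eq_two (hRr 1))
  have hP10 : W.P 1 + W.P 0 = 1 := by rw [add_comm]; exact W.P_sum
  have hR10 : conjProj W u 1 + conjProj W u 0 = 1 := by rw [add_comm]; exact conjProj_sum W u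
  have hR10' : conjProj W u 1 * conjProj W u 0 = 0 := by
    have hsum := conjProj_sum W u
    have : conjProj W u 0 = 1 - conjProj W u 1 := eq_sub_of_add_eq hsum
    rw [this, mul_sub, mul_one, conjProj_idem, sub_self]
  rcases hline 0 with h00 | h01 <;> rcases hline 1 with h10 | h11
  · exact absurd (h00.trans h10.symm) hne
  · -- `R 0 = P 0`, `R 1 = P 1`
    have e0 : conjProj W u 0 = W.P 0 :=
      eq_of_range_eq_of_range_compl_eq (conjProj_idem W u 0) (conjProj_mul_zero_one W u) W.P_sum h00 h11
    have e1 : conjProj W u 1 = W.P 1 :=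
      eq_of_range_eq_of_range_compl_eq (conjProj_idem W u 1) hR10' hP10 h11 h00
    exact map_torusT_eq_torusT'_of_conj W γ u hu hu' (i := 0) (i' := 1) (by decide)
      (Q_eq_of_conjProj_eq W u e0) (Q_eq_of_conjProj_eq W u e1)
  · -- `R 0 = P 1`, `R 1 = P 0`
    have e0 : conjProj W u 0 = W.P 1 :=
      eq_of_range_eq_of_range_compl_eq (conjProj_idem W u 0) (conjProj_mul_zero_one W u) hP10 h01 h10
    have e1 : conjProj W u 1 = W.P 0 :=
      eq_of_range_eq_of_range_compl_eq (conjProj_idem W u 1) hR10' W.P_sum h10 h01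
    exact map_torusT_eq_torusT'_of_conj W γ u hu hu' (i := 1) (i' := 0) (by decide)
      (Q_eq_of_conjProj_eq W u e0) (Q_eq_of_conjProj_eq W u e1)
  · exact absurd (h01.trans h11.symm) hne

end Dichotomy

end Summit.Ventures.HodgeRepro.Tier4.Line4

end
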